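import Summits.Ventures.HodgeRepro2.T5HermitianThreeElements
import Summits.Ventures.HodgeRepro2.T5CartanUnitaryRankOne

/-!
# T5UnitaryThreeCorner — `U(2,1)`: the corner lemma and the corner reduction

Blind cell pub-hodge-repro2, seat p8, Tier-5 kernel support (second file of the Cartan decomposition of
`U(antidiag(1, u, 1))`; the elements are T5HermitianThreeElements, the assembly is T5CartanUnitaryThree).

* `isInteger_inv_of_unit_sum` — THE UNIT-SUM LEMMA: over the fraction field `E` of a local ring `R`, with an
  involution preserving `R`-integrality, if `X, Y` are integral and `X · star Y + Y · star X` is a unit of `R`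
  then `X` and `Y` are units (in a local ring a unit sum has a unit summand);
* `exists_corner_dvd` — THE CORNER LEMMA: for `g ∈ U(2,1)` with some entry non-integral, one of the four
  CORNER entries is non-zero and divides every entry (an entry of maximal valuation in the middle row or
  column forces, through the isotropy relations and the unit-sum lemma, the corners of its row / column to
  have the same valuation);
* `corner_reduce` — THE CORNER REDUCTION: for `g = !![a,b,c; d,e,f; p,q,r] ∈ U(2,1)` with `a ≠ 0` dividing
  `b, c, d, p`, the unipotents `n⁻(y, w) · g · n(x, z)` with `x = −b/a`, `z = −(b x' + c)/a`, `y = −d/a`,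
  `w = −(y' d + p)/a` (`x' = −star x / u`, `y' = −u · star y`) give `diag(a, e₁, star(a)⁻¹)` with
  `star e₁ · e₁ = 1`, and the unipotents lie in `U(2,1) ∩ GL₃(R)`.

Hypotheses: `R` a DVR, `E = Frac R`, `star` preserving `R`-integrality, `u` a star-fixed unit of `R`.
-/

namespace Summit.Ventures.HodgeRepro2.T5UnitaryThreeCorner

open Summit.Ventures.HodgeRepro2 Matrix T5HermitianThreeElements

section UnitSum

variable {R : Type*} [CommRing R] [IsDomain R] [IsLocalRing R] {E : Type*} [Field E] [StarRing E]
  [Algebra R E] [IsFractionRing R E]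

omit [IsDomain R] [IsLocalRing R] [StarRing E] in
/-- `algebraMap r` has an integral inverse iff `r` is a unit (`r ≠ 0`). -/
theorem isUnit_of_isInteger_inv {r : R} (hr : algebraMap R E r ≠ 0)
    (h : IsLocalization.IsInteger R (algebraMap R E r)⁻¹) : IsUnit r := by
  obtain ⟨s, hs⟩ := h
  refine isUnit_iff_exists_inv.2 ⟨s, IsFractionRing.injective R E ?_⟩
  rw [map_mul, hs, map_one, mul_inv_cancel₀ hr]

omit [IsDomain R] [IsLocalRing R] [StarRing E] [IsFractionRing R E] in
/-- A unit of `R` has an integral inverse in `E`. -/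
theorem isInteger_inv_of_isUnit {r : R} (h : IsUnit r) :
    IsLocalization.IsInteger R (algebraMap R E r)⁻¹ := by
  obtain ⟨v, rfl⟩ := h
  refine ⟨((v⁻¹ : Rˣ) : R), ?_⟩
  rw [map_units_inv]

omit [IsDomain R] [IsLocalRing R] [IsFractionRing R E] in
/-- If `star` preserves integrality then so does `x ↦ star x⁻¹`. -/
theorem isInteger_star_inv (hstar : ∀ x : E, IsLocalization.IsInteger R x →
    IsLocalization.IsInteger R (star x)) {X : E} (h : IsLocalization.IsInteger R X⁻¹) :
    IsLocalization.IsInteger R (star X)⁻¹ := by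
  rw [← star_inv₀]; exact hstar _ h

omit [IsDomain R] in
/-- THE UNIT-SUM LEMMA: `X, Y` integral with `X · star Y + Y · star X` integral, non-zero and with integral
inverse (a unit of `R`) ⇒ `X⁻¹` and `Y⁻¹` are integral. -/
theorem isInteger_inv_of_unit_sum (hstar : ∀ x : E, IsLocalization.IsInteger R x →
    IsLocalization.IsInteger R (star x)) {X Y : E} (hX : IsLocalization.IsInteger R X)
    (hY : IsLocalization.IsInteger R Y) (hne : X * star Y + Y * star X ≠ 0)
    (hw : IsLocalization.IsInteger R (X * star Y + Y * star X)⁻¹) :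
    IsLocalization.IsInteger R X⁻¹ ∧ IsLocalization.IsInteger R Y⁻¹ := by
  obtain ⟨x, hx⟩ := hX
  obtain ⟨y, hy⟩ := hY
  obtain ⟨xs, hxs⟩ := hstar _ ⟨x, hx⟩
  obtain ⟨ys, hys⟩ := hstar _ ⟨y, hy⟩
  have hsum : algebraMap R E (x * ys + y * xs) = X * star Y + Y * star X := by
    rw [map_add, map_mul, map_mul, hx, hy, hxs, hys]
  have hunit : IsUnit (x * ys + y * xs) :=
    isUnit_of_isInteger_inv (by rw [hsum]; exact hne) (by rw [hsum]; exact hw)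
  -- a unit sum in a local ring has a unit summand
  rcases IsLocalRing.isUnit_or_isUnit_of_isUnit_add hunit with h | h
  · obtain ⟨hxu, hysu⟩ := IsUnit.mul_iff.1 h
    refine ⟨by rw [← hx]; exact isInteger_inv_of_isUnit hxu, ?_⟩
    have : IsLocalization.IsInteger R (star Y)⁻¹ := by
      rw [← hys]; exact isInteger_inv_of_isUnit hysu
    have := isInteger_star_inv hstar this
    rwa [star_star] at this
  · obtain ⟨hyu, hxsu⟩ := IsUnit.mul_iff.1 h
    refine ⟨?_, by rw [← hy]; exact isInteger_inv_of_isUnit hyu⟩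
    have : IsLocalization.IsInteger R (star X)⁻¹ := by
      rw [← hxs]; exact isInteger_inv_of_isUnit hxsu
    have := isInteger_star_inv hstar this
    rwa [star_star] at this

omit [IsDomain R] [StarRing E] in
/-- In a local ring, `m − 1` is a unit for every non-unit `m`, pulled back to `E`: `M` integral with `M⁻¹`
NOT integral ⇒ `(M − 1)⁻¹` integral and `M − 1 ≠ 0`. -/
theorem isInteger_inv_sub_one {M : E} (hM : IsLocalization.IsInteger R M)
    (hMu : ¬ IsLocalization.IsInteger R M⁻¹) :
    IsLocalization.IsInteger R (M - 1)⁻¹ ∧ M - 1 ≠ 0 := by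
  obtain ⟨m, hm⟩ := hM
  have hmu : ¬ IsUnit m := fun h => hMu (by rw [← hm]; exact isInteger_inv_of_isUnit h)
  have hunit : IsUnit (m - 1) := by
    have h1 : IsUnit (-1 : R) := isUnit_one.neg
    have : (-1 : R) = (m - 1) + (-m) := by ring
    rw [this] at h1
    rcases IsLocalRing.isUnit_or_isUnit_of_isUnit_add h1 with h | h
    · exact h
    · exact absurd ((IsUnit.neg_iff _).1 h) hmu
  have hM1 : algebraMap R E (m - 1) = M - 1 := by rw [map_sub, map_one, hm]
  refine ⟨by rw [← hM1]; exact isInteger_inv_of_isUnit hunit, ?_⟩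
  intro h0
  rw [← hM1] at h0
  have : m - 1 = 0 := IsFractionRing.injective R E (by rw [h0, map_zero])
  rw [this] at hunit
  exact not_isUnit_zero hunit

end UnitSum

section Corner

variable {R : Type*} [CommRing R] [IsDomain R] [IsDiscreteValuationRing R] {E : Type*} [Field E]
  [StarRing E] [Algebra R E] [IsFractionRing R E]

omit [IsDomain R] [IsDiscreteValuationRing R] [StarRing E] [IsFractionRing R E] in
/-- `x / c = (x / m) · (m / c)`: divisibility is transitive. -/
theorem isInteger_div_trans {x m c : E} (h1 : IsLocalization.IsInteger R (x / m))
    (h2 : IsLocalization.IsInteger R (m / c)) (hm : m ≠ 0) : IsLocalization.IsInteger R (x / c) := by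
  have : x / c = x / m * (m / c) := by field_simp
  rw [this]; exact IsLocalization.isInteger_mul h1 h2

/-- The row / column relation in the shape of the unit-sum lemma: from `X · star Y + Y · star X = −v` with
`v ≠ 0`, `v⁻¹` integral, `X, Y` integral, both `X` and `Y` are units. -/
theorem units_of_relation (hstar : ∀ x : E, IsLocalization.IsInteger R x →
    IsLocalization.IsInteger R (star x)) {X Y v : E} (hX : IsLocalization.IsInteger R X)
    (hY : IsLocalization.IsInteger R Y) (hv : v ≠ 0) (hvI : IsLocalization.IsInteger R v⁻¹)
    (hrel : X * star Y + Y * star X = -v) :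
    IsLocalization.IsInteger R X⁻¹ ∧ IsLocalization.IsInteger R Y⁻¹ :=
  isInteger_inv_of_unit_sum hstar hX hY (by rw [hrel]; exact neg_ne_zero.2 hv)
    (by rw [hrel, inv_neg]; obtain ⟨r, hr⟩ := hvI; exact ⟨-r, by rw [map_neg, hr]⟩)

/-- THE TRANSFER STEP: if `m ≠ 0` divides every entry, `X := a/m`, `Y := c/m` satisfy the relation
`a · star c + c · star a = −v · m · star m` with `v` a unit, then the corner `a` is non-zero and divides
every entry. -/
theorem corner_of_relation (hstar : ∀ x : E, IsLocalization.IsInteger R x →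
    IsLocalization.IsInteger R (star x)) (x : Fin 3 × Fin 3 → E) {m a c v : E} (hm : m ≠ 0)
    (hdiv : ∀ q, IsLocalization.IsInteger R (x q / m)) (ha : IsLocalization.IsInteger R (a / m))
    (hc : IsLocalization.IsInteger R (c / m)) (hv : v ≠ 0) (hvI : IsLocalization.IsInteger R v⁻¹)
    (hrel : a * star c + c * star a = -(v * (m * star m))) :
    a ≠ 0 ∧ ∀ q, IsLocalization.IsInteger R (x q / a) := by
  have hsm : star m ≠ 0 := T5HyperbolicUnitaryElements.star_ne_zero' hm
  have key : a / m * star (c / m) + c / m * star (a / m) = -v := by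
    rw [star_div₀, star_div₀]
    field_simp
    linear_combination hrel
  obtain ⟨hXi, -⟩ := units_of_relation hstar ha hc hv hvI key
  have ha0 : a ≠ 0 := by
    intro h0
    rw [h0, zero_div, star_zero, mul_zero, zero_mul, add_zero] at key
    exact hv (neg_eq_zero.1 key.symm)
  refine ⟨ha0, fun q => ?_⟩
  rw [inv_div] at hXi
  exact isInteger_div_trans (hdiv q) hXi hm

/-- THE CORNER LEMMA: `g ∈ U(antidiag(1, u, 1))` (`u` a star-fixed unit of `R`) with some entry
non-integral has a CORNER entry (`(0,0)`, `(0,2)`, `(2,0)` or `(2,2)`) that is non-zero and divides every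
entry. -/
theorem exists_corner_dvd (hstar : ∀ x : E, IsLocalization.IsInteger R x →
    IsLocalization.IsInteger R (star x)) (u : E) (hu : star u = u) (hu0 : u ≠ 0)
    (huI : IsLocalization.IsInteger R u) (huI' : IsLocalization.IsInteger R u⁻¹) (g : GL (Fin 3) E)
    (hmem : g ∈ T5UnitaryGroupForm.formUnitaryGroup (J3 u))
    (hni : ∃ i j, ¬ IsLocalization.IsInteger R ((g : Matrix (Fin 3) (Fin 3) E) i j)) :
    ∃ i j, (i = 0 ∨ i = 2) ∧ (j = 0 ∨ j = 2) ∧ (g : Matrix (Fin 3) (Fin 3) E) i j ≠ 0 ∧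
      ∀ k l, IsLocalization.IsInteger R ((g : Matrix (Fin 3) (Fin 3) E) k l /
        (g : Matrix (Fin 3) (Fin 3) E) i j) := by
  set x : Fin 3 × Fin 3 → E := fun q => (g : Matrix (Fin 3) (Fin 3) E) q.1 q.2 with hx
  have hne : ∃ q, x q ≠ 0 := by
    obtain ⟨i, j, hij⟩ := hni
    refine ⟨(i, j), fun h => hij ?_⟩
    change IsLocalization.IsInteger R (x (i, j))
    rw [h]
    exact IsLocalization.isInteger_zero
  obtain ⟨⟨i, j⟩, hm, hdiv⟩ := T5CartanUnitaryRankOne.exists_dvd_of_finite (R := R) x hne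
  -- names for the entries
  set a := (g : Matrix (Fin 3) (Fin 3) E) 0 0
  set b := (g : Matrix (Fin 3) (Fin 3) E) 0 1
  set c := (g : Matrix (Fin 3) (Fin 3) E) 0 2
  set d := (g : Matrix (Fin 3) (Fin 3) E) 1 0
  set e := (g : Matrix (Fin 3) (Fin 3) E) 1 1
  set f := (g : Matrix (Fin 3) (Fin 3) E) 1 2
  set p := (g : Matrix (Fin 3) (Fin 3) E) 2 0
  set q := (g : Matrix (Fin 3) (Fin 3) E) 2 1
  set r := (g : Matrix (Fin 3) (Fin 3) E) 2 2
  have hg : (g : Matrix (Fin 3) (Fin 3) E) = !![a, b, c; d, e, f; p, q, r] := Matrix.eta_fin_three _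
  obtain ⟨C1, -, -, -, C5, -, -, -, C9⟩ := (mem_iff_fin_three u g a b c d e f p q r hg).1 hmem
  obtain ⟨R1, -, -, -, -, -, R7, -, R9⟩ := row_relations u hu0 g a b c d e f p q r hg hmem
  -- the four transfer arguments
  have fromB : b ≠ 0 → (∀ q', IsLocalization.IsInteger R (x q' / b)) →
      a ≠ 0 ∧ ∀ q', IsLocalization.IsInteger R (x q' / a) := fun hb hdb =>
    corner_of_relation hstar x hb hdb (hdb (0, 0)) (hdb (0, 2)) (inv_ne_zero hu0)
      (by rw [inv_inv]; exact huI) (by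
        have hsu : star u = u := hu
        have : a * star c + c * star a = -(b * u⁻¹ * star b) := by linear_combination R1
        rw [this]; ring)
  have fromQ : q ≠ 0 → (∀ q', IsLocalization.IsInteger R (x q' / q)) →
      p ≠ 0 ∧ ∀ q', IsLocalization.IsInteger R (x q' / p) := fun hq hdq =>
    corner_of_relation hstar x hq hdq (hdq (2, 0)) (hdq (2, 2)) (inv_ne_zero hu0)
      (by rw [inv_inv]; exact huI) (by
        have : p * star r + r * star p = -(q * u⁻¹ * star q) := by linear_combination R9
        rw [this]; ring)
  have fromD : d ≠ 0 → (∀ q', IsLocalization.IsInteger R (x q' / d)) →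
      a ≠ 0 ∧ ∀ q', IsLocalization.IsInteger R (x q' / a) := fun hd hdd =>
    corner_of_relation hstar x hd hdd (hdd (0, 0)) (hdd (2, 0)) hu0 huI' (by
        have : a * star p + p * star a = -(star d * u * d) := by linear_combination C1
        rw [this]; ring)
  have fromF : f ≠ 0 → (∀ q', IsLocalization.IsInteger R (x q' / f)) →
      c ≠ 0 ∧ ∀ q', IsLocalization.IsInteger R (x q' / c) := fun hf hdf =>
    corner_of_relation hstar x hf hdf (hdf (0, 2)) (hdf (2, 2)) hu0 huI' (by
        have : c * star r + r * star c = -(star f * u * f) := by linear_combination C9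
        rw [this]; ring)
  fin_cases i <;> fin_cases j
  · exact ⟨0, 0, Or.inl rfl, Or.inl rfl, hm, fun k l => hdiv (k, l)⟩
  · obtain ⟨ha, hda⟩ := fromB hm hdiv
    exact ⟨0, 0, Or.inl rfl, Or.inl rfl, ha, fun k l => hda (k, l)⟩
  · exact ⟨0, 2, Or.inl rfl, Or.inr rfl, hm, fun k l => hdiv (k, l)⟩
  · obtain ⟨ha, hda⟩ := fromD hm hdiv
    exact ⟨0, 0, Or.inl rfl, Or.inl rfl, ha, fun k l => hda (k, l)⟩
  · -- the middle entry: first to `b`, then to the corner `a`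
    have hm' : e ≠ 0 := hm
    have hdiv' : ∀ q', IsLocalization.IsInteger R (x q' / e) := hdiv
    have heni : ¬ IsLocalization.IsInteger R e := by
      intro he
      obtain ⟨i', j', hij⟩ := hni
      apply hij
      have : (g : Matrix (Fin 3) (Fin 3) E) i' j' = x (i', j') / e * e := by
        show x (i', j') = x (i', j') / e * e
        field_simp
      rw [this]
      exact IsLocalization.isInteger_mul (hdiv' (i', j')) he
    have heI : IsLocalization.IsInteger R e⁻¹ := by
      rcases ValuationRing.isInteger_or_isInteger R e with h | h
      · exact absurd h heni
      · exact h
    have hseI : IsLocalization.IsInteger R (star e)⁻¹ := isInteger_star_inv hstar heI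
    have hMI : IsLocalization.IsInteger R (e⁻¹ * (star e)⁻¹) := IsLocalization.isInteger_mul heI hseI
    have hMu : ¬ IsLocalization.IsInteger R (e⁻¹ * (star e)⁻¹)⁻¹ := by
      intro h
      -- a unit product in R: both factors units, so e⁻¹ is a unit, so e is integral
      obtain ⟨m1, hm1⟩ := heI
      obtain ⟨m2, hm2⟩ := hseI
      have hprod : algebraMap R E (m1 * m2) = e⁻¹ * (star e)⁻¹ := by rw [map_mul, hm1, hm2]
      have hne' : e⁻¹ * (star e)⁻¹ ≠ 0 :=
        mul_ne_zero (inv_ne_zero hm') (inv_ne_zero (T5HyperbolicUnitaryElements.star_ne_zero' hm'))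
      have := isUnit_of_isInteger_inv (E := E) (by rw [hprod]; exact hne') (by rw [hprod]; exact h)
      obtain ⟨hm1u, -⟩ := IsUnit.mul_iff.1 this
      apply heni
      have := isInteger_inv_of_isUnit (E := E) hm1u
      rwa [hm1, inv_inv] at this
    obtain ⟨hwI, hw0⟩ := isInteger_inv_sub_one (R := R) hMI hMu
    -- the column-2 relation: (b/e) star (q/e) + (q/e) star (b/e) = u (M − 1)
    have hb : b ≠ 0 ∧ ∀ q', IsLocalization.IsInteger R (x q' / b) := by
      refine corner_of_relation hstar x (m := e) hm' hdiv' (hdiv' (0, 1)) (hdiv' (2, 1))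
        (v := -(u * (e⁻¹ * (star e)⁻¹ - 1))) (neg_ne_zero.2 (mul_ne_zero hu0 hw0)) ?_ ?_
      · rw [inv_neg, mul_inv]
        obtain ⟨r1, hr1⟩ := huI'
        obtain ⟨r2, hr2⟩ := hwI
        exact ⟨-(r1 * r2), by rw [map_neg, map_mul, hr1, hr2]⟩
      · have hse : star e ≠ 0 := T5HyperbolicUnitaryElements.star_ne_zero' hm'
        have : b * star q + q * star b = u - star e * u * e := by linear_combination C5
        rw [this]
        field_simp
    obtain ⟨ha, hda⟩ := fromB hb.1 hb.2
    exact ⟨0, 0, Or.inl rfl, Or.inl rfl, ha, fun k l => hda (k, l)⟩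
  · obtain ⟨hc, hdc⟩ := fromF hm hdiv
    exact ⟨0, 2, Or.inl rfl, Or.inr rfl, hc, fun k l => hdc (k, l)⟩
  · exact ⟨2, 0, Or.inr rfl, Or.inl rfl, hm, fun k l => hdiv (k, l)⟩
  · obtain ⟨hp, hdp⟩ := fromQ hm hdiv
    exact ⟨2, 0, Or.inr rfl, Or.inl rfl, hp, fun k l => hdp (k, l)⟩
  · exact ⟨2, 2, Or.inr rfl, Or.inr rfl, hm, fun k l => hdiv (k, l)⟩

omit [IsDomain R] [IsDiscreteValuationRing R] [StarRing E] [IsFractionRing R E] in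
/-- Integrality bookkeeping: `−(x / a)` is integral when `x / a` is. -/
theorem isInteger_neg_div {x a : E} (h : IsLocalization.IsInteger R (x / a)) :
    IsLocalization.IsInteger R (-(x / a)) := by
  obtain ⟨r, hr⟩ := h; exact ⟨-r, by rw [map_neg, hr]⟩

omit [IsDomain R] [IsDiscreteValuationRing R] [StarRing E] [IsFractionRing R E] in
/-- Integrality bookkeeping: negation. -/
theorem isInteger_neg {x : E} (h : IsLocalization.IsInteger R x) : IsLocalization.IsInteger R (-x) := by
  obtain ⟨r, hr⟩ := h; exact ⟨-r, by rw [map_neg, hr]⟩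

omit [IsDomain R] [IsDiscreteValuationRing R] [StarRing E] [IsFractionRing R E] in
/-- Integrality bookkeeping: subtraction. -/
theorem isInteger_sub {x y : E} (hx : IsLocalization.IsInteger R x) (hy : IsLocalization.IsInteger R y) :
    IsLocalization.IsInteger R (x - y) := by
  rw [sub_eq_add_neg]; exact IsLocalization.isInteger_add hx (isInteger_neg hy)

omit [IsDomain R] [IsDiscreteValuationRing R] [StarRing E] in
/-- A unit of `GL ι E` with integral entries and integral entries of its inverse lies in `GL ι(R)`. -/
theorem mem_range_of_integral {ι : Type*} [Fintype ι] [DecidableEq ι] (g : GL ι E)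
    (hent : ∀ i j, IsLocalization.IsInteger R ((g : Matrix ι ι E) i j))
    (hent' : ∀ i j, IsLocalization.IsInteger R (((g⁻¹ : GL ι E) : Matrix ι ι E) i j)) :
    g ∈ (Matrix.GeneralLinearGroup.map (algebraMap R E)).range := by
  choose M hM using hent
  choose M' hM' using hent'
  refine T5CongruenceConjugation.mem_range_of_map_eq (IsFractionRing.injective R E) g (Matrix.of M)
    (Matrix.of M') ?_ ?_
  · ext i j; rw [Matrix.map_apply, Matrix.of_apply, hM]
  · ext i j; rw [Matrix.map_apply, Matrix.of_apply, hM']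

omit [IsDomain R] [IsDiscreteValuationRing R] [Algebra R E] [IsFractionRing R E] in
/-- The inverse of `g ∈ U(antidiag(1, u, 1))` is `J⁻¹ gᴴ J`, entrywise. -/
theorem coe_inv_eq (u : E) (hu0 : u ≠ 0) (g : GL (Fin 3) E) (a b c d e f p q r : E)
    (hg : (g : Matrix (Fin 3) (Fin 3) E) = !![a, b, c; d, e, f; p, q, r])
    (hmem : g ∈ T5UnitaryGroupForm.formUnitaryGroup (J3 u)) :
    ((g⁻¹ : GL (Fin 3) E) : Matrix (Fin 3) (Fin 3) E) =
      !![star r, u * star f, star c; u⁻¹ * star q, star e, u⁻¹ * star b; star p, u * star d, star a] := by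
  rw [T5UnitaryGroupForm.mem_formUnitaryGroup_iff, J3_eq] at hmem
  apply Units.inv_eq_of_mul_eq_one_left
  have hM : !![star r, u * star f, star c; u⁻¹ * star q, star e, u⁻¹ * star b; star p, u * star d, star a] =
      !![0, 0, 1; 0, u⁻¹, 0; 1, 0, 0] * (g : Matrix (Fin 3) (Fin 3) E)ᴴ * !![0, 0, 1; 0, u, 0; 1, 0, 0] := by
    rw [hg, T5HeisenbergCommutator.conjTranspose_fin_three, Matrix.mul_fin_three, Matrix.mul_fin_three, fin_three_eq_iff]
    refine ⟨by ring, by ring, by ring, by ring, by field_simp; ring, by ring, by ring, by ring, by ring⟩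
  rw [hM]
  calc !![0, 0, 1; 0, u⁻¹, 0; 1, 0, 0] * (g : Matrix (Fin 3) (Fin 3) E)ᴴ * !![0, 0, 1; 0, u, 0; 1, 0, 0] *
        (g : Matrix (Fin 3) (Fin 3) E)
      = !![0, 0, 1; 0, u⁻¹, 0; 1, 0, 0] *
          ((g : Matrix (Fin 3) (Fin 3) E)ᴴ * !![0, 0, 1; 0, u, 0; 1, 0, 0] * (g : Matrix (Fin 3) (Fin 3) E)) := by
        simp only [Matrix.mul_assoc]
    _ = 1 := by rw [hmem, J3inv_mul_J3 u hu0]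

omit [IsDomain R] [IsDiscreteValuationRing R] in
/-- An element of `U(antidiag(1, u, 1))` with integral entries lies in `GL₃(R)` (`u` a star-fixed unit). -/
theorem mem_range_of_entries (hstar : ∀ x : E, IsLocalization.IsInteger R x →
    IsLocalization.IsInteger R (star x)) (u : E) (hu0 : u ≠ 0) (huI : IsLocalization.IsInteger R u)
    (huI' : IsLocalization.IsInteger R u⁻¹) (g : GL (Fin 3) E)
    (hmem : g ∈ T5UnitaryGroupForm.formUnitaryGroup (J3 u))
    (hent : ∀ i j, IsLocalization.IsInteger R ((g : Matrix (Fin 3) (Fin 3) E) i j)) :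
    g ∈ (Matrix.GeneralLinearGroup.map (algebraMap R E)).range := by
  refine mem_range_of_integral g hent fun i j => ?_
  rw [coe_inv_eq u hu0 g _ _ _ _ _ _ _ _ _ (Matrix.eta_fin_three _) hmem]
  fin_cases i <;> fin_cases j <;> simp only [Matrix.of_apply, Matrix.cons_val', Matrix.cons_val_zero,
    Matrix.cons_val_one, Matrix.cons_val_two, Matrix.empty_val', Matrix.cons_val_fin_one, Fin.mk_one,
    Fin.reduceFinMk, Fin.isValue]
  · exact hstar _ (hent 2 2)
  · exact IsLocalization.isInteger_mul huI (hstar _ (hent 1 2))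
  · exact hstar _ (hent 0 2)
  · exact IsLocalization.isInteger_mul huI' (hstar _ (hent 2 1))
  · exact hstar _ (hent 1 1)
  · exact IsLocalization.isInteger_mul huI' (hstar _ (hent 0 1))
  · exact hstar _ (hent 2 0)
  · exact IsLocalization.isInteger_mul huI (hstar _ (hent 1 0))
  · exact hstar _ (hent 0 0)


end Corner

end Summit.Ventures.HodgeRepro2.T5UnitaryThreeCorner
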